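import Summits.BirchSwinnertonDyer.Rank1Residual.Additive.KodairaCondExpThree
import HarnessLib

/-!
# THE DICTIONARY at `3`: the census cells of an additive `3` ARE the Kodaira types — (M) = `Iₙ*`
# (`n ≥ 1`), (G-ord) = `I₀*`, (t′) = `III`/`III*`, (w) = `II`/`IV`/`IV*`/`II*`; row T-b9 in census
# currency: **X4 at `3`, `f₃ = 2`, `ρ̄_{E,3}` onto ⟹ the `3`-adic tower**, EXOTIC ⊂ (w)
# (cell `b2b-bsdres`, team n1011, seat p14 gen 2 — part 2, sequel of `Additive/KodairaCondExpThree.lean`)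

HONEST FRAMING (cell `b2b-bsdres`, run/shared/lean/b2b/bsd-rank1-residual/, verbatim in every
file): the goal of the cell is to DELETE the COMBINATION-SHAPED residual classes of the
Birch–Swinnerton-Dyer formula for ALL analytic-rank `≤ 1` elliptic curves over `ℚ` — "full BSD
formula for every rank `≤ 1` curve in class `C`" assembled STRICTLY from published theorems — so
that the rank-`≤ 1` remainder becomes exactly the CONSTRUCTION-SHAPED classes, which are TYPED
(missing-input `Prop`s), NOT attempted. This is not "finishing BSD". Team n1011 (N10 / N11, the
additive block X4 ∧ `p = 3`): research route; no claim beyond the stated classes; labels UNCHANGED;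
nothing is booked. Theorems only (no definition, no named fact minted; every published input of the
end-state is an explicit named-fact hypothesis, as in p250513 / p251574 / p256589).

## What this file proves

For `W/ℚ` elliptic and globally minimal with `Addv W 3`, `K₃ := W.kodairaSymbolAt (placeOf 3)`; the
census cells are the hyp seat's DATA predicates of `Additive/SharpenedStatements.lean`
(`PotMult` = `ord₃ j < 0`, `CondExpTwo` = `f₃ = 2`, `SubGord`, `SubTprime`, `SubW`):

* §3 `kodairaSymbolAt_three_cases_of_addv` (the additive symbol sorted by cell);
  `typeG_three_iff_kodairaSymbolAt_Istar_zero` ((G) ⟺ `I₀*`);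
  `condExpTwo_three_iff_kodairaSymbolAt_tame` (`f₃ = 2` ⟺ `Iₙ*`/`III`/`III*`);
  `subW_three_iff_kodairaSymbolAt_wild` ((w) ⟺ `II`/`IV`/`IV*`/`II*`);
  `subTprime_three_iff_kodairaSymbolAt_III_or_IIIstar` ((t′) ⟺ `III`/`III*`);
  `subGord_three_iff_kodairaSymbolAt_Istar_zero` ((G-ord) ⟺ `I₀*`) — with part 1's
  `potMult_three_iff_kodairaSymbolAt_Istar_succ` ((M) ⟺ `Iₙ*`, `n ≥ 1`) this is the complete
  dictionary cited (not proved) in `Additive/WildThreeKrausCells.lean`.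
* §4 ROW T-b9 IN CENSUS CURRENCY: **`ClassX4.towerSurj_three_of_surj_of_condExpTwo`** — X4 at `3`,
  "tame" `f₃ = 2`, `ρ̄_{E,3}` onto ⟹ `ρ̄_{E,3ⁿ}` onto for every `n` (target T3 of
  `cells/n1011/skel/T-b9-tame-tower.md` verbatim: `Addv W 3 → f₃ = 2 → Surj W 3 → ∀ n, …`);
  `ClassX4.subW_of_not_towerSurj_three` — the EXOTIC residue (surj(3), tower fails) lies in the
  census cell (w) = class O6 (`v₃(N) ≥ 3`); `ClassX4.towerSurj_three_of_surj_of_not_subW`,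
  `…_of_subTprime`, `ClassX4.imageContainsSL2_three_of_surj_of_condExpTwo` (Kato (12.5.2));
  `exotic_iff_exotic_of_subW` and the END-STATE
  **`x4SharpUnitFree_iff_lower_and_residues_sharp_exoticSubW_noL20`** — p251574's eight-fact
  end-state with the EXOTIC piece quantified over the cell (w) only.

Census reading (EVIDENCE, `HOME/b2b-bsdres-n1011-p14/tb1/T-b1-ENGINE1-v1.2-ADDENDUM.md`): (w) ∩
surj(3) ∩ X4@3 `r_an = 0` = 20 970 cells.  Nothing booked; X4 CONSTRUCTION-SHAPED; no label change.

References: [SilvermanATAEC1994] IV.9.4, Table 4.1, IV.10–11; A. Kraus, Manuscripta Math. 69 (1990)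
353–385; [Wuthrich2014] Lemma 20 (p. 399); [Kato2004Asterisque] (12.5.2) p. 222, Thm. 14.5 (3).
-/

noncomputable section

open scoped Classical NumberField

open WeierstrassCurve IsDedekindDomain IsDedekindDomain.HeightOneSpectrum NumberField
  Rat.HeightOneSpectrum Literature.NumberTheory.EllipticCurves
  Literature.NumberTheory.EllipticCurves.ModularForms
  Literature.NumberTheory.EllipticCurves.Rank1Residual
  Literature.NumberTheory.EllipticCurves.Rank1Residual.Typed
  Literature.NumberTheory.DiophantineGeometry
  Summit.BirchSwinnertonDyer.Rank1Residual.GaloisImage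

namespace Summit.BirchSwinnertonDyer.Rank1Residual.Additive

/-! ### §3 The dictionary on the additive locus at `3` -/

section Dictionary

variable (W : WeierstrassCurve ℚ) [W.IsElliptic]

/-- **The additive Kodaira symbol at `3`, sorted by census cell**: for `E` additive at `3`, exactly
one of — `Iₙ*` with `n ≥ 1` ((M)); `I₀*` ((G)); `III` or `III*` ((t′)); `II`, `IV`, `IV*` or `II*`
((w)). [cite: SilvermanAEC2009, VII.5 Prop. 5.1] [cite: SilvermanATAEC1994, IV Table 4.1 (PDF p. 365)] -/
theorem kodairaSymbolAt_three_cases_of_addv [Fact (Nat.Prime 3)] (hadd : Addv W 3) :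
    (∃ n : ℕ, W.kodairaSymbolAt (placeOf 3) = .Istar (n + 1)) ∨
      W.kodairaSymbolAt (placeOf 3) = .Istar 0 ∨
      (W.kodairaSymbolAt (placeOf 3) = .III ∨ W.kodairaSymbolAt (placeOf 3) = .IIIstar) ∨
      (W.kodairaSymbolAt (placeOf 3) = .II ∨ W.kodairaSymbolAt (placeOf 3) = .IV ∨
        W.kodairaSymbolAt (placeOf 3) = .IVstar ∨ W.kodairaSymbolAt (placeOf 3) = .IIstar) := by
  have hk := isAdditive_kodairaSymbolAt_placeOf_of_addv W 3 hadd
  rcases hks : W.kodairaSymbolAt (placeOf 3) with (_ | n) | _ | _ | _ | (_ | n) | _ | _ | _ <;>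
    rw [hks] at hk
  · exact absurd rfl hk.1
  · exact absurd ⟨_, Nat.succ_ne_zero _, rfl⟩ hk.2
  · exact Or.inr (Or.inr (Or.inr (Or.inl rfl)))
  · exact Or.inr (Or.inr (Or.inl (Or.inl rfl)))
  · exact Or.inr (Or.inr (Or.inr (Or.inr (Or.inl rfl))))
  · exact Or.inr (Or.inl rfl)
  · exact Or.inl ⟨n, rfl⟩
  · exact Or.inr (Or.inr (Or.inr (Or.inr (Or.inr (Or.inl rfl)))))
  · exact Or.inr (Or.inr (Or.inl (Or.inr rfl)))
  · exact Or.inr (Or.inr (Or.inr (Or.inr (Or.inr (Or.inr rfl)))))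

/-- **(G) at `3` ⟺ Kodaira `I₀*`** on the additive locus (`TypeG W 3 ↔ K₃ = I₀*`): (←) is
`typeG_three_of_kodairaSymbolAt_eq_Istar_zero`; (→) (G) forces `ord₃ j ≥ 0`, `f₃ = 2`
(`condExpTwo_three_of_typeG_of_addv`) and `e = 2` (`semistabilityIndex_eq_two_of_typeG_three`),
which excludes `Iₙ*` (`n ≥ 1`), the wild types (`f₃ ≥ 3`) and `III`/`III*`
(`ord₃ Δ_min = 3, 9`, `e = 4`). [cite: SilvermanATAEC1994, IV.9.4 Step 6 and Table 4.1 (PDF pp. 345, 365)] -/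
theorem typeG_three_iff_kodairaSymbolAt_Istar_zero [W.IsGloballyMinimal] [Fact (Nat.Prime 3)]
    (hadd : Addv W 3) :
    TypeG W 3 ↔ W.kodairaSymbolAt (placeOf 3) = .Istar 0 := by
  refine ⟨fun hG ↦ ?_, typeG_three_of_kodairaSymbolAt_eq_Istar_zero W⟩
  have hj := padicValRat_j_nonneg_of_typeG W 3 hG
  have hf := condExpTwo_three_of_typeG_of_addv W hG hadd
  have he := semistabilityIndex_eq_two_of_typeG_three W hG hadd
  haveI : PerfectField (IsLocalRing.ResidueField ((placeOf 3).adicCompletionIntegers ℚ)) :=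
    PerfectField.ofFinite
  have h2 : ringChar (ℤ ⧸ (placeOf 3).asIdeal) ≠ 2 := by rw [ringChar_int_quot_placeOf 3]; decide
  rcases kodairaSymbolAt_three_cases_of_addv W hadd with ⟨n, hn⟩ | h0 | hIII | hwild
  · exact absurd (padicValRat_j_neg_of_kodairaSymbolAt_eq_Istar_succ W hn) (not_lt.mpr hj)
  · exact h0
  · exfalso
    have hord := W.ordMinimalDiscriminant_eq_numComponentsAt_add_one_of_kodairaSymbolAt (placeOf 3) h2
      (hIII.elim Or.inl fun h ↦ Or.inr (Or.inl h))
    rw [ordMinimalDiscriminant_placeOf_eq W 3] at hord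
    unfold numComponentsAt at hord
    unfold semistabilityIndex at he
    rcases hIII with h | h <;> rw [h] at hord <;>
      simp only [KodairaSymbol.numComponents] at hord <;> rw [hord] at he <;>
      exact absurd he (by decide)
  · exact absurd hf (not_condExpTwo_three_of_kodairaSymbolAt_wild W hwild)

/-- **"Tame" at `3` (`f₃ = 2`) ⟺ Kodaira `Iₙ*` (`n ≥ 0`), `III` or `III*`** on the additive locus.
[cite: SilvermanATAEC1994, IV.10.4 and Table 4.1 (PDF p. 365)] -/
theorem condExpTwo_three_iff_kodairaSymbolAt_tame [Fact (Nat.Prime 3)] (hadd : Addv W 3) :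
    CondExpTwo W 3 ↔ (W.kodairaSymbolAt (placeOf 3) = .III ∨ W.kodairaSymbolAt (placeOf 3) = .IIIstar ∨
      ∃ n, W.kodairaSymbolAt (placeOf 3) = .Istar n) := by
  refine ⟨fun hf ↦ ?_, condExpTwo_three_of_kodairaSymbolAt_tame W⟩
  rcases kodairaSymbolAt_three_cases_of_addv W hadd with ⟨n, hn⟩ | h0 | hIII | hwild
  · exact Or.inr (Or.inr ⟨_, hn⟩)
  · exact Or.inr (Or.inr ⟨_, h0⟩)
  · exact hIII.elim Or.inl fun h ↦ Or.inr (Or.inl h)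
  · exact absurd hf (not_condExpTwo_three_of_kodairaSymbolAt_wild W hwild)

/-- **The wild cell (w) at `3` ⟺ Kodaira `II`, `IV`, `IV*` or `II*`** on the additive locus
(`SubW W 3 = ¬(M) ∧ f₃ ≠ 2`). This is the class O6 of the additive odd locus (Kraus 1990: `3 ∣ #Φ`).
[cite: SilvermanATAEC1994, IV.10.4 and Table 4.1 (PDF p. 365)] -/
theorem subW_three_iff_kodairaSymbolAt_wild [Fact (Nat.Prime 3)] (hadd : Addv W 3) :
    SubW W 3 ↔ (W.kodairaSymbolAt (placeOf 3) = .II ∨ W.kodairaSymbolAt (placeOf 3) = .IV ∨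
      W.kodairaSymbolAt (placeOf 3) = .IVstar ∨ W.kodairaSymbolAt (placeOf 3) = .IIstar) := by
  unfold SubW
  constructor
  · rintro ⟨hj, hf⟩
    rcases kodairaSymbolAt_three_cases_of_addv W hadd with ⟨n, hn⟩ | h0 | hIII | hwild
    · exact absurd (padicValRat_j_neg_of_kodairaSymbolAt_eq_Istar_succ W hn) hj
    · exact absurd (condExpTwo_three_of_kodairaSymbolAt_tame W (Or.inr (Or.inr ⟨_, h0⟩))) hf
    · exact absurd (condExpTwo_three_of_kodairaSymbolAt_tame W
        (hIII.elim Or.inl fun h ↦ Or.inr (Or.inl h))) hf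
    · exact hwild
  · intro hwild
    refine ⟨fun hj ↦ ?_, not_condExpTwo_three_of_kodairaSymbolAt_wild W hwild⟩
    obtain ⟨n, hn⟩ := exists_kodairaSymbolAt_eq_Istar_succ_of_potMult_three W hadd hj
    rw [hn] at hwild
    simp at hwild

/-- **The cell (t′) at `3` ⟺ Kodaira `III` or `III*`** on the additive locus
(`SubTprime W 3 = ¬(M) ∧ f₃ = 2 ∧ e ∤ 2`: tame, potentially good, not `I₀*` — there `e = 4`).
[cite: SilvermanATAEC1994, IV.9.4 Steps 4, 9 and Table 4.1 (PDF pp. 344–346, 365)] -/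
theorem subTprime_three_iff_kodairaSymbolAt_III_or_IIIstar [W.IsGloballyMinimal] [Fact (Nat.Prime 3)]
    (hadd : Addv W 3) :
    SubTprime W 3 ↔
      (W.kodairaSymbolAt (placeOf 3) = .III ∨ W.kodairaSymbolAt (placeOf 3) = .IIIstar) := by
  haveI : PerfectField (IsLocalRing.ResidueField ((placeOf 3).adicCompletionIntegers ℚ)) :=
    PerfectField.ofFinite
  have h2 : ringChar (ℤ ⧸ (placeOf 3).asIdeal) ≠ 2 := by rw [ringChar_int_quot_placeOf 3]; decide
  have he4 : (W.kodairaSymbolAt (placeOf 3) = .III ∨ W.kodairaSymbolAt (placeOf 3) = .IIIstar) →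
      semistabilityIndex W 3 = 4 := by
    intro hIII
    have hord := W.ordMinimalDiscriminant_eq_numComponentsAt_add_one_of_kodairaSymbolAt (placeOf 3) h2
      (hIII.elim Or.inl fun h ↦ Or.inr (Or.inl h))
    rw [ordMinimalDiscriminant_placeOf_eq W 3] at hord
    unfold numComponentsAt at hord
    unfold semistabilityIndex
    rcases hIII with h | h <;> rw [h] at hord <;> simp only [KodairaSymbol.numComponents] at hord <;>
      rw [hord] <;> decide
  unfold SubTprime
  constructor
  · rintro ⟨hj, hf, he⟩
    rcases kodairaSymbolAt_three_cases_of_addv W hadd with ⟨n, hn⟩ | h0 | hIII | hwild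
    · exact absurd (padicValRat_j_neg_of_kodairaSymbolAt_eq_Istar_succ W hn) hj
    · exact absurd (by rw [semistabilityIndex_eq_two_of_typeG_three W
        (typeG_three_of_kodairaSymbolAt_eq_Istar_zero W h0) hadd]) he
    · exact hIII
    · exact absurd hf (not_condExpTwo_three_of_kodairaSymbolAt_wild W hwild)
  · intro hIII
    refine ⟨fun hj ↦ ?_, condExpTwo_three_of_kodairaSymbolAt_tame W
      (hIII.elim Or.inl fun h ↦ Or.inr (Or.inl h)), by rw [he4 hIII]; decide⟩
    obtain ⟨n, hn⟩ := exists_kodairaSymbolAt_eq_Istar_succ_of_potMult_three W hadd hj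
    rw [hn] at hIII
    simp at hIII

/-- **The cell (G-ord) at `3` ⟺ Kodaira `I₀*`** on the additive locus (`subGord_three_iff_typeG` +
`typeG_three_iff_kodairaSymbolAt_Istar_zero`). [cite: SilvermanATAEC1994, IV.9.4 Step 6 (PDF p. 345)] -/
theorem subGord_three_iff_kodairaSymbolAt_Istar_zero [W.IsGloballyMinimal] [Fact (Nat.Prime 3)]
    (hadd : Addv W 3) :
    SubGord W 3 ↔ W.kodairaSymbolAt (placeOf 3) = .Istar 0 := by
  rw [subGord_three_iff_typeG W hadd, typeG_three_iff_kodairaSymbolAt_Istar_zero W hadd]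

end Dictionary

/-! ### §4 Row T-b9 in census currency: tame ⟹ tower; EXOTIC ⊂ (w) -/

section Census

variable {W : WeierstrassCurve ℚ} [W.IsElliptic] [W.IsGloballyMinimal]

/-- **T3 (census currency). X4 at `3`, TAME (`f₃ = 2`), `ρ̄_{E,3}` onto ⟹ `ρ̄_{E,3ⁿ}` onto for
every `n`** — the target `Addv W 3 → f₃ = 2 → Surj W 3 → ∀ n, …` of `cells/n1011/skel/T-b9-tame-tower.md`:
`f₃ = 2` excludes the wild types (`not_condExpTwo_three_of_kodairaSymbolAt_wild`), and
`ClassX4.towerSurj_three_of_surj_of_kodairaSymbolAt_not_wild` (p256589). No binder, no certificate.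
[cite: Wuthrich2014, Lemma 20 (p. 399)] [cite: SerreAbelianLadic1968, Ch. IV §3.4, Lemma 3 (IV-23)]
[cite: SilvermanATAEC1994, IV Table 4.1 (PDF p. 365)] -/
theorem ClassX4.towerSurj_three_of_surj_of_condExpTwo [Fact (Nat.Prime 3)] (hX : ClassX4 W 3)
    (hf : CondExpTwo W 3) (hsurj : Surj W 3) (n : ℕ) : W.HasSurjectiveModNGaloisRep (3 ^ n : ℕ) :=
  ClassX4.towerSurj_three_of_surj_of_kodairaSymbolAt_not_wild hX hsurj
    (fun hw ↦ not_condExpTwo_three_of_kodairaSymbolAt_wild W hw hf) n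

/-- **Kato's (12.5.2) at `3` on every tame X4 row** (`f₃ = 2`, surj(3)).
[cite: Kato2004Asterisque, (12.5.2) (p. 222)] [cite: Wuthrich2014, Lemma 20 (p. 399)] -/
theorem ClassX4.imageContainsSL2_three_of_surj_of_condExpTwo [Fact (Nat.Prime 3)] (hX : ClassX4 W 3)
    (hf : CondExpTwo W 3) (hsurj : Surj W 3) : Kato2004.ImageContainsSL2 W 3 :=
  (Kato2004.imageContainsSL2_iff_forall_hasSurjectiveModNGaloisRep W 3).mpr
    (ClassX4.towerSurj_three_of_surj_of_condExpTwo hX hf hsurj)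

/-- **The tower on the cell (t′) at `3`** (`¬(M)`, `f₃ = 2`, `e ∤ 2`: Kodaira `III`/`III*`) from
surj(3). [cite: Wuthrich2014, Lemma 20 (p. 399)] -/
theorem ClassX4.towerSurj_three_of_surj_of_subTprime [Fact (Nat.Prime 3)] (hX : ClassX4 W 3)
    (hT : SubTprime W 3) (hsurj : Surj W 3) (n : ℕ) : W.HasSurjectiveModNGaloisRep (3 ^ n : ℕ) :=
  ClassX4.towerSurj_three_of_surj_of_condExpTwo hX hT.2.1 hsurj n

/-- **T4 (census currency). THE EXOTIC RESIDUE LIES IN THE WILD CELL (w) = class O6**: an X4 pair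
at `3` with `ρ̄_{E,3}` onto whose `3`-adic tower fails has `¬(M) ∧ f₃ ≠ 2` (`SubW W 3`;
`v₃(N) ∈ {3, 4, 5}`). [cite: Wuthrich2014, Lemma 20 (p. 399)] [cite: SilvermanATAEC1994, IV Table 4.1 (PDF p. 365)] -/
theorem ClassX4.subW_of_not_towerSurj_three [Fact (Nat.Prime 3)] (hX : ClassX4 W 3) (hsurj : Surj W 3)
    (hnot : ¬ ∀ n : ℕ, W.HasSurjectiveModNGaloisRep (3 ^ n : ℕ)) : SubW W 3 :=
  (subW_three_iff_kodairaSymbolAt_wild W hX.2.1).mpr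
    (ClassX4.kodairaSymbolAt_wild_of_not_towerSurj_three hX hsurj hnot)

/-- **The tower on (M) ∪ (G-ord) ∪ (t′) at `3`** — every X4 row at `3` OUTSIDE the wild cell (w)
has `ρ̄_{E,3ⁿ}` onto for all `n` from surj(3) alone. [cite: Wuthrich2014, Lemma 20 (p. 399)] -/
theorem ClassX4.towerSurj_three_of_surj_of_not_subW [Fact (Nat.Prime 3)] (hX : ClassX4 W 3)
    (hsurj : Surj W 3) (hS : ¬ SubW W 3) (n : ℕ) : W.HasSurjectiveModNGaloisRep (3 ^ n : ℕ) := by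
  by_contra h
  exact hS (ClassX4.subW_of_not_towerSurj_three hX hsurj fun hall ↦ h (hall n))

end Census

/-! ### §5 The X4 end-state with the EXOTIC piece on the cell (w) only -/

/-- **The EXOTIC hypothesis of the end-state, RESTRICTED to the census cell (w).**  p251574's
EXOTIC piece (`p = 3`, `r_an = 0`, X4, surj(3), `ord₃ j ≥ 0`, `¬ TypeG W 3`, tower fails ⟹ upper)
is EQUIVALENT to the same statement on the rows of the wild cell `SubW W 3` (`¬(M) ∧ f₃ ≠ 2`):
`ord₃ j ≥ 0` and `¬ TypeG` follow from (w) (resp. from the failing tower, `TypeG.towerSurj_three_of_surj`),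
and a failing tower forces (w) (`ClassX4.subW_of_not_towerSurj_three`).
[cite: Wuthrich2014, Lemma 20 (p. 399)] [cite: SilvermanATAEC1994, IV Table 4.1 (PDF p. 365)] -/
theorem exotic_iff_exotic_of_subW :
    (∀ (W : WeierstrassCurve ℚ) [W.IsElliptic] [W.IsGloballyMinimal],
        W.analyticRank = 0 → ClassX4 W 3 → Surj W 3 → 0 ≤ padicValRat 3 W.j → ¬ TypeG W 3 →
        ¬ (∀ n : ℕ, W.HasSurjectiveModNGaloisRep (3 ^ n : ℕ)) → MissingUpperBoundAt W 3) ↔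
    (∀ (W : WeierstrassCurve ℚ) [W.IsElliptic] [W.IsGloballyMinimal],
        W.analyticRank = 0 → ClassX4 W 3 → Surj W 3 → SubW W 3 →
        ¬ (∀ n : ℕ, W.HasSurjectiveModNGaloisRep (3 ^ n : ℕ)) → MissingUpperBoundAt W 3) := by
  haveI : Fact (Nat.Prime 3) := ⟨Nat.prime_three⟩
  constructor
  · intro h V _ _ hr hX hs hS hnot
    have hj : 0 ≤ padicValRat 3 V.j := by
      have h1 := hS.1
      unfold PotMult at h1
      exact not_lt.mp h1
    exact h V hr hX hs hj (fun hG ↦ hnot (TypeG.towerSurj_three_of_surj hG hX.2.1 hs)) hnot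
  · intro h V _ _ hr hX hs _ _ hnot
    exact h V hr hX hs (ClassX4.subW_of_not_towerSurj_three hX hs hnot) hnot

/-- **THE END-STATE OF CLASS X4 ON EIGHT NAMED FACTS with the EXOTIC piece on the WILD CELL (w)
only: X4♯(unit-free) ⟺ LOWER ∧ EXOTIC((w) at `3`) ∧ TAM-DEFECT₂♭ ∧ ODD-SHA♭ ∧ MANIN♭** — p251574's
`x4SharpUnitFree_iff_lower_and_residues_sharp_exoticTypeG_noL20` rewritten along
`exotic_iff_exotic_of_subW`: the EXOTIC residue (surj(3), tower fails ⟹ upper half) is quantified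
over the rows of the census cell `SubW W 3` (`ord₃ j ≥ 0 ∧ f₃ ≠ 2`, i.e. `v₃(N) ∈ {3,4,5}`) only —
no (M), (G-ord) or (t′) row of X4 at `3` is exotic.  No named fact beyond the eight; X4 stays
CONSTRUCTION-SHAPED; nothing booked. [cite: Kato2004Asterisque, Thm. 14.5 (3) (p. 236), Thm. 17.4 (3) (p. 273)]
[cite: Delbourgo1998, Prop. 4 (p. 144)] [cite: Wuthrich2014, Lemma 20 (p. 399)] [cite: SilvermanAEC2009, Thm. X.4.14]
[cite: Kim2022StructureSelmer, Conj. 1.10 (PDF p. 8)] [cite: Miller2011LMS, Def. 1.1] -/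
theorem x4SharpUnitFree_iff_lower_and_residues_sharp_exoticSubW_noL20
    (hCT : exists_casselsTate_pairing (K := ℚ))
    (hKatoS : Kato2004.rankZero_padicValNat_sha_le_sub_localTamagawa_of_additive_potGood_of_imageContainsSL2)
    (hDel : Delbourgo1998.prop4_rankZero_pow_dvd_constantCoeff)
    (hGZK : rank_eq_analyticRank_of_analyticRank_le_one) (hmod : hasEntireLFunction_rat)
    (hmodD : nonempty_modularParametrizationData)
    (hKatoχ : Wuthrich2014.kato_halfEigenCharIdeal_dvd_cyclotomicPrime_of_surjective)
    (hK : Kato2004.charIdeal_dvd_padicLFunctionBranch_component_of_surjective) :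
    X4SharpUnitFree ↔
      (∀ (W : WeierstrassCurve ℚ) [W.IsElliptic] [W.IsGloballyMinimal] (p : ℕ) [Fact p.Prime],
          W.analyticRank = 0 → ClassX4 W p → Surj W p → MissingLowerBoundAt W p) ∧
      (∀ (W : WeierstrassCurve ℚ) [W.IsElliptic] [W.IsGloballyMinimal],
          W.analyticRank = 0 → ClassX4 W 3 → Surj W 3 → SubW W 3 →
          ¬ (∀ n : ℕ, W.HasSurjectiveModNGaloisRep (3 ^ n : ℕ)) → MissingUpperBoundAt W 3) ∧
      (∀ (W : WeierstrassCurve ℚ) [W.IsElliptic] [W.IsGloballyMinimal] (p : ℕ) [Fact p.Prime],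
          W.analyticRank = 0 → ClassX4 W p → Surj W p → 0 ≤ padicValRat p W.j →
          ¬ (TypeGOrd W p ∧ semistabilityIndex W p = 2) →
          padicValNat p ((W.baseChange ℚ_[p]).localTamagawaNumber ℤ_[p]) + 2 ≤
            padicValNat p W.tamagawaProduct →
          MissingUpperBoundAt W p) ∧
      (∀ (W : WeierstrassCurve ℚ) [W.IsElliptic] [W.IsGloballyMinimal] (p : ℕ) [Fact p.Prime],
          W.analyticRank = 0 → ClassX4 W p → Surj W p → 0 ≤ padicValRat p W.j →
          ¬ (TypeGOrd W p ∧ semistabilityIndex W p = 2) →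
          (∃ q : ℚ, shaAn W = (q : ℂ) ∧ Odd (padicValRat p q)) → MissingUpperBoundAt W p) ∧
      (∀ (W : WeierstrassCurve ℚ) [W.IsElliptic] [W.IsGloballyMinimal] (p : ℕ) [Fact p.Prime],
          W.analyticRank = 0 → ClassX4 W p → Surj W p → 0 ≤ padicValRat p W.j →
          ¬ (TypeGOrd W p ∧ semistabilityIndex W p = 2) →
          (∀ (N : ℕ) [NeZero N] (D : ModularParametrizationData W N), (p : ℤ) ∣ D.maninConstant) →
          MissingUpperBoundAt W p) := by
  rw [x4SharpUnitFree_iff_lower_and_residues_sharp_exoticTypeG_noL20 hCT hKatoS hDel hGZK hmod hmodD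
    hKatoχ hK, exotic_iff_exotic_of_subW]

end Summit.BirchSwinnertonDyer.Rank1Residual.Additive

end
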